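import Summits.Parity.GeneralizedHardyLittlewood.Theorems.FordMaynardNoSieveConst0164NegWitness0164J3Pieces

/-!
# Route `FordMaynardNoSieveConst0164`, crux `NegWitness0164` (stmt-Parity-19102), line `birth`,
# stub `stub_tweakNeg0164`: enclosure layer — elementary majorants for the α-families (II')

Helper file toward the certificate stub (K. Ford, J. Maynard, *On the theory of prime producing sieves*,
arXiv:2407.14368, §8).  The second numerical target (II') of `stub_tweakNeg0164_of_numerics` (`…Numerics`) asks, for
each of the 49 cell families `β` and uniformly in `α ∈ [a_lo(β), a_hi(β)]`, for an UPPER bound of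
`(α/6) Σ_t lpCoeff0164(t) ∫_{Δ₃(α) ∩ cell} 1/(v₀v₁v₂)` by `1 + F₄(α)`, `F₄(α) = log(α/max(ν, α − 1/2) − 1)` (`ν = 41/250`).
Float reconnaissance (this hand, recorded on the item): the 14 binding families have slack `4.0e−3`; the product of the
three CHORDS of `1/vᵢ` over a whole cell loses `5e−3` (too much), while the quadratic Taylor majorant below loses only
`3e−4`.  This file provides the pointwise inequalities such a replay rests on (all elementary, def-free):

* `inv_le_taylor_0164` — `1/v ≤ 1/p − (v−p)/p² + (v−p)²/(p²a)` for `0 < a ≤ v`, `0 < p` (exact Taylor identity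
  `1/v = 1/p − (v−p)/p² + (v−p)²/(p²v)` plus `v ≥ a`);
* `inv_prod_three_le_taylor_0164` — the product of the three majorants dominates `1/(v₀v₁v₂)` on a box `v ≥ a`;
* `log_weighted_chord_0164` — concavity chord of `log`: `(x₂−x)·log x₁ + (x−x₁)·log x₂ ≤ (x₂−x₁)·log x`;
* `neg_log_tangent_0164` — convexity tangent of `−log`: `−log y₀ − (y−y₀)/y₀ ≤ −log y`;
* `F4_lower_chord_0164` — on `[α₁, α₂] ⊂ (ν, 1/2 + ν]`, certified `ℓᵢ ≤ log(αᵢ/ν − 1)` give the affine lower bound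
  `((α₂−α)ℓ₁ + (α−α₁)ℓ₂)/(α₂−α₁) ≤ log(α/ν − 1)` of the right-hand side of (II').

References: [FordMaynard2024PrimeSieves] arXiv:2407.14368, §8 (proof of Theorem 2.7 (c): `F₄(α)`); the inequalities are
folklore (Taylor with Lagrange remainder, concavity of `log`).
-/

noncomputable section

open Finset MeasureTheory Set
open scoped Classical
open Literature.NumberTheory.Sieve Literature.NumberTheory.Sieve.FordMaynard

namespace Summit.Parity.GeneralizedHardyLittlewood.FordMaynardNoSieveConst0164NegWitness0164

/-! ### The quadratic Taylor majorant of `1/v` -/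

/-- **Quadratic Taylor majorant of `1/v`**: for `0 < a ≤ v` and `0 < p`,
`1/v ≤ 1/p − (v−p)/p² + (v−p)²/(p²a)` (from the identity `1/v − 1/p + (v−p)/p² = (v−p)²/(p²v)`). [folklore] -/
theorem inv_le_taylor_0164 {a p v : ℝ} (ha : 0 < a) (hav : a ≤ v) (hp : 0 < p) :
    1 / v ≤ 1 / p - (v - p) / p ^ 2 + (v - p) ^ 2 / (p ^ 2 * a) := by
  have hv : 0 < v := lt_of_lt_of_le ha hav
  have hv' : v ≠ 0 := hv.ne'
  have hp' : p ≠ 0 := hp.ne'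
  have key : 1 / v - (1 / p - (v - p) / p ^ 2) = (v - p) ^ 2 / (p ^ 2 * v) := by
    field_simp
    ring
  have hrem : (v - p) ^ 2 / (p ^ 2 * v) ≤ (v - p) ^ 2 / (p ^ 2 * a) := by
    apply div_le_div_of_nonneg_left (sq_nonneg _) (by positivity)
    exact mul_le_mul_of_nonneg_left hav (by positivity)
  linarith

/-- The quadratic Taylor majorant is nonnegative wherever it dominates `1/v > 0`. [folklore] -/
theorem taylor_majorant_nonneg_0164 {a p v : ℝ} (ha : 0 < a) (hav : a ≤ v) (hp : 0 < p) :
    0 ≤ 1 / p - (v - p) / p ^ 2 + (v - p) ^ 2 / (p ^ 2 * a) :=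
  le_trans (div_nonneg zero_le_one (lt_of_lt_of_le ha hav).le) (inv_le_taylor_0164 ha hav hp)

/-- **Majorant of `1/(v₀v₁v₂)` on a box**: for `0 < aᵢ ≤ vᵢ` and `0 < pᵢ`, the product of the three quadratic Taylor
majorants dominates `1/(v₀v₁v₂)` (a polynomial of degree `≤ 2` in each variable, so that its integral over a cell slice
is a combination of section moments of order `≤ 2` per coordinate). [folklore] -/
theorem inv_prod_three_le_taylor_0164 {a p v : Fin 3 → ℝ} (ha : ∀ i, 0 < a i) (hav : ∀ i, a i ≤ v i)
    (hp : ∀ i, 0 < p i) :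
    1 / (v 0 * v 1 * v 2) ≤
      (1 / p 0 - (v 0 - p 0) / p 0 ^ 2 + (v 0 - p 0) ^ 2 / (p 0 ^ 2 * a 0)) *
      (1 / p 1 - (v 1 - p 1) / p 1 ^ 2 + (v 1 - p 1) ^ 2 / (p 1 ^ 2 * a 1)) *
      (1 / p 2 - (v 2 - p 2) / p 2 ^ 2 + (v 2 - p 2) ^ 2 / (p 2 ^ 2 * a 2)) := by
  have hv : ∀ i, 0 < v i := fun i => lt_of_lt_of_le (ha i) (hav i)
  have h0 := inv_le_taylor_0164 (ha 0) (hav 0) (hp 0)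
  have h1 := inv_le_taylor_0164 (ha 1) (hav 1) (hp 1)
  have h2 := inv_le_taylor_0164 (ha 2) (hav 2) (hp 2)
  have e : 1 / (v 0 * v 1 * v 2) = 1 / v 0 * (1 / v 1) * (1 / v 2) := by
    rw [one_div_mul_one_div, one_div_mul_one_div]
  rw [e]
  have g0 : 0 ≤ 1 / v 0 := div_nonneg zero_le_one (hv 0).le
  have g1 : 0 ≤ 1 / v 1 := div_nonneg zero_le_one (hv 1).le
  have g2 : 0 ≤ 1 / v 2 := div_nonneg zero_le_one (hv 2).le
  exact mul_le_mul (mul_le_mul h0 h1 g1 (le_trans g0 h0)) h2 g2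
    (mul_nonneg (le_trans g0 h0) (le_trans g1 h1))

/-! ### Affine bounds for the logarithmic right-hand side -/

/-- **Concavity chord of `log`**: for `0 < x₁`, `x₁ ≤ x ≤ x₂`,
`(x₂ − x)·log x₁ + (x − x₁)·log x₂ ≤ (x₂ − x₁)·log x` (from `log y ≤ y − 1` twice). [folklore] -/
theorem log_weighted_chord_0164 {x₁ x₂ x : ℝ} (hx₁ : 0 < x₁) (h₁ : x₁ ≤ x) (h₂ : x ≤ x₂) :
    (x₂ - x) * Real.log x₁ + (x - x₁) * Real.log x₂ ≤ (x₂ - x₁) * Real.log x := by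
  have hx : 0 < x := lt_of_lt_of_le hx₁ h₁
  have hx₂ : 0 < x₂ := lt_of_lt_of_le hx h₂
  have e1 := Real.log_le_sub_one_of_pos (div_pos hx₁ hx)
  have e2 := Real.log_le_sub_one_of_pos (div_pos hx₂ hx)
  rw [Real.log_div hx₁.ne' hx.ne'] at e1
  rw [Real.log_div hx₂.ne' hx.ne'] at e2
  rw [div_sub_one hx.ne'] at e1 e2
  have e : (x₂ - x) * ((x₁ - x) / x) + (x - x₁) * ((x₂ - x) / x) = 0 := by ring
  have e1' := mul_le_mul_of_nonneg_left e1 (by linarith : (0 : ℝ) ≤ x₂ - x)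
  have e2' := mul_le_mul_of_nonneg_left e2 (by linarith : (0 : ℝ) ≤ x - x₁)
  linarith

/-- **Convexity tangent of `−log`**: for `0 < y₀`, `0 < y`, `−log y₀ − (y − y₀)/y₀ ≤ −log y`. [folklore] -/
theorem neg_log_tangent_0164 {y₀ y : ℝ} (hy₀ : 0 < y₀) (hy : 0 < y) :
    -Real.log y₀ - (y - y₀) / y₀ ≤ -Real.log y := by
  have e := Real.log_le_sub_one_of_pos (div_pos hy hy₀)
  rw [Real.log_div hy.ne' hy₀.ne', div_sub_one hy₀.ne'] at e
  linarith

/-- **Affine lower bound of `F₄` on a family range** (`ν = 41/250`, lower regime `F₄(α) = log(α/ν − 1)`): for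
`ν < α₁ ≤ α ≤ α₂` and certified `ℓ₁ ≤ log(α₁/ν − 1)`, `ℓ₂ ≤ log(α₂/ν − 1)` with `α₁ < α₂`,
`((α₂ − α)ℓ₁ + (α − α₁)ℓ₂)/(α₂ − α₁) ≤ log(α/ν − 1)`.
[cite: FordMaynard2024PrimeSieves, §8 ("F₄(α) = log(α/max(ν, α−1/2) − 1)")] -/
theorem F4_lower_chord_0164 {α₁ α₂ α ℓ₁ ℓ₂ : ℝ} (hα₁ : 41 / 250 < α₁) (h₁ : α₁ ≤ α) (h₂ : α ≤ α₂) (h12 : α₁ < α₂)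
    (hℓ₁ : ℓ₁ ≤ Real.log (α₁ / (41 / 250) - 1)) (hℓ₂ : ℓ₂ ≤ Real.log (α₂ / (41 / 250) - 1)) :
    ((α₂ - α) * ℓ₁ + (α - α₁) * ℓ₂) / (α₂ - α₁) ≤ Real.log (α / (41 / 250) - 1) := by
  have hx₁ : 0 < α₁ / (41 / 250) - 1 := by
    rw [sub_pos, lt_div_iff₀ (by norm_num : (0 : ℝ) < 41 / 250)]; linarith
  have hc := log_weighted_chord_0164 (x₁ := α₁ / (41 / 250) - 1) (x := α / (41 / 250) - 1)
    (x₂ := α₂ / (41 / 250) - 1) hx₁ (by rw [sub_le_sub_iff_right]; exact div_le_div_of_nonneg_right h₁ (by norm_num))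
    (by rw [sub_le_sub_iff_right]; exact div_le_div_of_nonneg_right h₂ (by norm_num))
  -- rescale the weights: (x₂ − x) = (α₂ − α)/ν etc.
  have ew : ∀ s t : ℝ, s / (41 / 250) - 1 - (t / (41 / 250) - 1) = (250 / 41) * (s - t) := by
    intro s t; ring
  rw [ew, ew, ew] at hc
  have hw1 := mul_le_mul_of_nonneg_left hℓ₁ (by linarith : (0 : ℝ) ≤ α₂ - α)
  have hw2 := mul_le_mul_of_nonneg_left hℓ₂ (by linarith : (0 : ℝ) ≤ α - α₁)
  rw [div_le_iff₀ (by linarith : (0 : ℝ) < α₂ - α₁)]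
  nlinarith [hc, hw1, hw2]

end Summit.Parity.GeneralizedHardyLittlewood.FordMaynardNoSieveConst0164NegWitness0164

end
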